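import Mathlib.RingTheory.MvPolynomial.WeightedHomogeneous
import Mathlib.Algebra.MvPolynomial.Division
import Mathlib.Tactic
import Literature.AlgebraicGeometry.Resolution.WeightedMonomialIdeals
import HarnessLib

/-!
# Weighted quasi-regularity of a permutable regular family

Topic: `Literature/AlgebraicGeometry/Resolution`. Continuation of `WeightedMonomialIdeals.lean`
(same local notation `J[S, m] = (u^β : supp β ⊆ S, Σ wᵢ βᵢ ≥ m)`). PROVED:

* `coeff_mem_span_of_isWeightedHomogeneous` — **weighted quasi-regularity**: if the `uᵢ`, `i ∈ S`,
  form a permutable regular family with positive weights and a `w`-homogeneous polynomial `P` of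
  weight `n` in the variables of `S` has `P(u) ∈ J[S, n + 1]`, then every coefficient of `P` lies in
  `(uᵢ : i ∈ S)`. Equivalently the graded ring `⊕ₙ J[S, n]/J[S, n+1]` of the weighted filtration is
  the weighted polynomial ring over `A/(uᵢ : i ∈ S)` — for all weights `1` this is Rees' theorem
  "a regular sequence is quasi-regular" (Matsumura, Thm. 16.2 (i); tree: `QuasiRegularSequences.lean`),
  and in general it is what identifies the exceptional fibre ring `A[t⁻¹, uᵢ t^{wᵢ}]/(t⁻¹)` of
  Włodarczyk's full cobordant blow-up with a polynomial ring over the centre (arXiv:2203.03090,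
  §2.3.9, §4.1 "weighted normal bundle").

Proof: induction on the weight `n` and on the set of variables, splitting `P = Xᵢ Q + P₀` and using
the colon lemmas of `WeightedMonomialIdeals.lean`.

## Sources

* H. Matsumura, *Commutative Ring Theory*, CUP 1986, Thm. 16.2. [Matsumura1987]
* J. Włodarczyk, arXiv:2203.03090, §2.3.9 and §4.1. [Wlodarczyk2022]
-/

noncomputable section

open MvPolynomial

namespace Literature.AlgebraicGeometry.Resolution

universe u v

variable {A : Type u} [CommRing A] {ι : Type v} (u : ι → A) (w : ι → ℕ)

/-- The weighted monomial ideal `J[S, m] = (u^β : supp β ⊆ S, Σ wᵢ βᵢ ≥ m)` of the sub-family of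
`u` indexed by `S` (local notation, as in `WeightedMonomialIdeals.lean`). -/
local notation3 "J[" S ", " m "]" => Ideal.span {x : A | ∃ β : ι →₀ ℕ, (↑β.support : Set ι) ⊆ S ∧
  m ≤ Finsupp.weight w β ∧ β.prod (fun i e => u i ^ e) = x}

/-! ## Weighted quasi-regularity -/

/-- `J[S, a] · J[S, b] ⊆ J[S, a + b]`. [folklore] -/
theorem weightedSpan_mul_le (S : Set ι) (a b : ℕ) : J[S, a] * J[S, b] ≤ J[S, a + b] := by
  rw [Ideal.span_mul_span']
  refine Ideal.span_mono ?_
  classical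
  rintro _ ⟨x, ⟨α, hαS, hα, rfl⟩, y, ⟨β, hβS, hβ, rfl⟩, rfl⟩
  refine ⟨α + β, ?_, ?_, ?_⟩
  · intro i hi
    rcases Finset.mem_union.mp (Finsupp.support_add hi) with h | h
    · exact hαS h
    · exact hβS h
  · rw [map_add]; omega
  · exact prod_pow_add u α β

/-- With positive weights, `(uᵢ : i ∈ S) ⊆ J[S, 1]`. [folklore] -/
theorem span_le_weightedSpan_one {S : Set ι} (hw : ∀ i ∈ S, 0 < w i) :
    Ideal.span (u '' S) ≤ J[S, 1] := by
  refine Ideal.span_le.mpr ?_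
  rintro _ ⟨i, hi, rfl⟩
  have e : u i = (Finsupp.single i 1).prod (fun i e => u i ^ e) := by
    rw [Finsupp.prod_single_index (h := fun i e => u i ^ e) (pow_zero _), pow_one]
  rw [SetLike.mem_coe, e]
  refine prod_mem_weightedSpan u w ?_ ?_
  · intro j hj
    classical
    rw [Finset.mem_coe, Finsupp.support_single _ one_ne_zero, Finset.mem_singleton] at hj
    rw [hj]; exact hi
  · rw [Finsupp.weight_single, smul_eq_mul, one_mul]
    exact hw i hi

/-- A `w`-homogeneous polynomial of weight `n` whose monomials are supported in `T` evaluates at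
`u` into `J[T, n]`. [folklore] -/
theorem eval_mem_weightedSpan {T : Set ι} {n : ℕ} {P : MvPolynomial ι A}
    (hP : P.IsWeightedHomogeneous w n) (hT : ∀ β, P.coeff β ≠ 0 → (↑β.support : Set ι) ⊆ T) :
    MvPolynomial.eval u P ∈ J[T, n] := by
  rw [P.as_sum, map_sum]
  refine Ideal.sum_mem _ fun β hβ => ?_
  rw [MvPolynomial.eval_monomial]
  refine Ideal.mul_mem_left _ _ (prod_mem_weightedSpan u w (hT β (mem_support_iff.mp hβ)) ?_)
  exact (hP (mem_support_iff.mp hβ)).ge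

/-- **Weighted quasi-regularity of a permutable regular family.** Let `S` be a finite set of
indices with positive weights such that the `uᵢ`, `i ∈ S`, form a permutable regular family (each
`uᵢ` is a non-zero-divisor modulo `(u_t : t ∈ T)` for every `T ⊆ S ∖ {i}`). If a `w`-homogeneous
polynomial `P` of weight `n` in the variables of `S` satisfies `P(u) ∈ J[S, n + 1]`, then all the
coefficients of `P` lie in `(uᵢ : i ∈ S)`. Equivalently: the associated graded ring
`⊕ₙ J[S, n] / J[S, n + 1]` of the weighted filtration is the weighted polynomial ring
`(A / (uᵢ : i ∈ S))[Xᵢ : i ∈ S]`. For all weights `1` this is Rees' theorem "regular ⇒ quasi-regular"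
(Matsumura, Thm. 16.2 (i)); the weighted case is the algebra behind the regularity of Włodarczyk's
cobordant blow-up at a regular weighted centre (arXiv:2203.03090, §2.3.9). [folklore] -/
theorem coeff_mem_span_of_isWeightedHomogeneous (S : Finset ι) (hw : ∀ i ∈ S, 0 < w i)
    (hperm : ∀ i ∈ S, ∀ T : Set ι, T ⊆ ↑S → i ∉ T → ∀ y : A,
      u i * y ∈ Ideal.span (u '' T) → y ∈ Ideal.span (u '' T))
    {n : ℕ} {P : MvPolynomial ι A} (hP : P.IsWeightedHomogeneous w n)
    (hvars : ∀ β, P.coeff β ≠ 0 → (↑β.support : Set ι) ⊆ ↑S)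
    (heval : MvPolynomial.eval u P ∈ J[↑S, n + 1]) (β : ι →₀ ℕ) :
    P.coeff β ∈ Ideal.span (u '' ↑S) := by
  classical
  -- the colon lemma (C) with `K = ⊥`, for subsets of `S`
  have hC : ∀ (S₀ : Finset ι), S₀ ⊆ S → ∀ x : A, (∀ T : Set ι, T ⊆ ↑S₀ → ∀ y : A,
      x * y ∈ Ideal.span (u '' T) → y ∈ Ideal.span (u '' T)) →
      ∀ (m : ℕ) (y : A), x * y ∈ J[↑S₀, m] → y ∈ J[↑S₀, m] := by
    intro S₀ hS₀ x hx m y hy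
    have key := (colon_weightedSpan_aux u w S₀ ⊥ (fun i hi => hw i (hS₀ hi))
      (fun i hi T hT hiT z hz => by
        rw [bot_sup_eq] at hz ⊢
        exact hperm i (hS₀ hi) T (hT.trans (Finset.coe_subset.mpr hS₀)) hiT z hz)).1 x
      (fun T hT z hz => by
        rw [bot_sup_eq] at hz ⊢
        exact hx T hT z hz) m y
    rw [bot_sup_eq] at key
    exact key hy
  -- main statement, by strong induction on the weight and induction on the set of variables
  suffices key : ∀ n, ∀ S' : Finset ι, S' ⊆ S → ∀ P : MvPolynomial ι A,
      P.IsWeightedHomogeneous w n → (∀ β, P.coeff β ≠ 0 → (↑β.support : Set ι) ⊆ ↑S') →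
      MvPolynomial.eval u P ∈ J[↑S, n + 1] → ∀ β, P.coeff β ∈ Ideal.span (u '' ↑S) from
    key n S le_rfl P hP hvars heval β
  intro n
  induction n using Nat.strong_induction_on with
  | _ n ihn =>
    intro S'
    induction S' using Finset.induction_on with
    | empty =>
      -- no variables: `P` is a constant of weight `n`
      intro _ P hP hvars heval β
      by_cases hβ : P.coeff β = 0
      · rw [hβ]; exact Ideal.zero_mem _
      have hβ0 : β = 0 := by
        have := hvars β hβ
        rw [Finset.coe_empty, Set.subset_empty_iff, Finset.coe_eq_empty, Finsupp.support_eq_empty] at this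
        exact this
      subst hβ0
      have hn : n = 0 := by
        have := hP hβ
        simpa using this.symm
      subst hn
      -- `P = C (coeff 0 P)` and `P(u) = coeff 0 P ∈ J[S, 1] ⊆ (u)`
      have hPC : P = MvPolynomial.C (P.coeff 0) := by
        ext γ
        rw [MvPolynomial.coeff_C]
        split_ifs with h
        · rw [← h]
        · by_contra hγ
          have := hvars γ hγ
          rw [Finset.coe_empty, Set.subset_empty_iff, Finset.coe_eq_empty, Finsupp.support_eq_empty] at this
          exact h this.symm
      rw [hPC, MvPolynomial.eval_C] at heval
      exact weightedSpan_le_span u w _ le_rfl heval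
    | insert i S'' hiS'' ihS =>
      intro hS' P hP hvars heval β
      have hiS : i ∈ S := hS' (Finset.mem_insert_self i S'')
      have hS''S : S'' ⊆ S := fun j hj => hS' (Finset.mem_insert_of_mem hj)
      -- split `P = Xᵢ Q + P₀`
      set Q := P.divMonomial (Finsupp.single i 1) with hQdef
      set P₀ := P.modMonomial (Finsupp.single i 1) with hP₀def
      have hsplit : MvPolynomial.X i * Q + P₀ = P := P.divMonomial_add_modMonomial_single i
      have hcQ : ∀ γ, Q.coeff γ = P.coeff (Finsupp.single i 1 + γ) := fun γ =>
        MvPolynomial.coeff_divMonomial _ _ _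
      have hcP₀ : ∀ γ, P₀.coeff γ = if γ i = 0 then P.coeff γ else 0 := by
        intro γ
        split_ifs with h
        · exact MvPolynomial.coeff_modMonomial_of_not_le _ (by
            rw [Finsupp.single_le_iff]; omega)
        · exact MvPolynomial.coeff_modMonomial_of_le _ (by
            rw [Finsupp.single_le_iff]; omega)
      -- `P₀` is homogeneous of weight `n` in the variables `S''`
      have hP₀ : P₀.IsWeightedHomogeneous w n := by
        intro γ hγ
        rw [hcP₀] at hγ
        split_ifs at hγ with h
        · exact hP hγ
        · exact absurd rfl hγ
      have hvars₀ : ∀ γ, P₀.coeff γ ≠ 0 → (↑γ.support : Set ι) ⊆ ↑S'' := by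
        intro γ hγ
        rw [hcP₀] at hγ
        split_ifs at hγ with h
        · intro j hj
          have hj' := hvars γ hγ hj
          rw [Finset.coe_insert, Set.mem_insert_iff] at hj'
          rcases hj' with rfl | hj'
          · exact absurd h (Finsupp.mem_support_iff.mp hj)
          · exact hj'
        · exact absurd rfl hγ
      -- `Q` is homogeneous of weight `n - wᵢ` in the variables `insert i S''`, and `wᵢ ≤ n` if `Q ≠ 0`
      have hQw : ∀ γ, Q.coeff γ ≠ 0 → Finsupp.weight w γ + w i = n := by
        intro γ hγ
        rw [hcQ] at hγ
        have := hP hγ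
        rw [map_add, Finsupp.weight_single, smul_eq_mul, one_mul] at this
        omega
      have hQ : Q.IsWeightedHomogeneous w (n - w i) := by
        intro γ hγ
        have := hQw γ hγ
        omega
      have hvarsQ : ∀ γ, Q.coeff γ ≠ 0 → (↑γ.support : Set ι) ⊆ ↑(insert i S'') := by
        intro γ hγ j hj
        rw [hcQ] at hγ
        refine hvars _ hγ ?_
        exact Finsupp.support_mono le_add_self hj
      -- evaluation: `uᵢ Q(u) + P₀(u) ∈ J[S, n+1] = uᵢ J[S, n+1-wᵢ] + J[S ∖ i, n+1]`
      have hev : u i * MvPolynomial.eval u Q + MvPolynomial.eval u P₀ ∈ J[↑S, n + 1] := by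
        rw [← hsplit, map_add, map_mul, MvPolynomial.eval_X] at heval
        exact heval
      have hP₀ev : MvPolynomial.eval u P₀ ∈ J[↑S \ {i}, n] :=
        eval_mem_weightedSpan u w hP₀ (fun γ hγ => (hvars₀ γ hγ).trans (by
          rw [Set.subset_sdiff, Set.disjoint_singleton_right]
          exact ⟨Finset.coe_subset.mpr hS''S, by exact_mod_cast hiS''⟩))
      rw [weightedSpan_eq_sup u w (Finset.mem_coe.mpr hiS)] at hev
      obtain ⟨a, ha, q, hq, haq⟩ := Submodule.mem_sup.mp hev
      obtain ⟨j, hj, rfl⟩ := Ideal.mem_span_singleton_mul.mp ha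
      have h1 : u i * (MvPolynomial.eval u Q - j) ∈ J[↑(S.erase i), n] := by
        have e : u i * (MvPolynomial.eval u Q - j) = q - MvPolynomial.eval u P₀ := by
          linear_combination -haq
        rw [e, Finset.coe_erase]
        exact Ideal.sub_mem _ (weightedSpan_antitone u w _ (Nat.le_succ n) hq) hP₀ev
      have h2 : MvPolynomial.eval u Q - j ∈ J[↑(S.erase i), n] := by
        refine hC (S.erase i) (Finset.erase_subset i S) (u i) ?_ n _ h1
        intro T hT z hz
        refine hperm i hiS T (hT.trans ?_) ?_ z hz
        · rw [Finset.coe_erase]; exact Set.sdiff_subset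
        · intro hiT
          have := hT hiT
          rw [Finset.coe_erase] at this
          exact this.2 rfl
      -- coefficients of `Q` lie in `(u)`, by induction on the weight
      have hQcoeff : ∀ γ, Q.coeff γ ∈ Ideal.span (u '' ↑S) := by
        intro γ
        by_cases hQ0 : Q.coeff γ = 0
        · rw [hQ0]; exact Ideal.zero_mem _
        have hwin : w i ≤ n := by have := hQw γ hQ0; omega
        have hQev : MvPolynomial.eval u Q ∈ J[↑S, (n - w i) + 1] := by
          have e : MvPolynomial.eval u Q = (MvPolynomial.eval u Q - j) + j := by ring
          rw [e]
          refine Ideal.add_mem _ ?_ ?_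
          · refine (show J[↑(S.erase i), n] ≤ J[↑S, n - w i + 1] from ?_) h2
            rw [Finset.coe_erase]
            refine (weightedSpan_mono u w Set.sdiff_subset n).trans (weightedSpan_antitone u w _ ?_)
            have := hw i hiS
            omega
          · refine (weightedSpan_antitone u w _ ?_) hj
            omega
        exact ihn (n - w i) (by have := hw i hiS; omega) (insert i S'') hS' Q hQ hvarsQ hQev γ
      -- hence `uᵢ Q(u) ∈ J[S, n+1]` and `P₀(u) ∈ J[S, n+1]`
      have hQev1 : u i * MvPolynomial.eval u Q ∈ J[↑S, n + 1] := by
        rw [Q.as_sum, map_sum, Finset.mul_sum]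
        refine Ideal.sum_mem _ fun γ hγ => ?_
        rw [MvPolynomial.eval_monomial, mul_left_comm]
        have hw1 : u i * γ.prod (fun i e => u i ^ e) ∈ J[↑S, n] := by
          have e : u i * γ.prod (fun i e => u i ^ e) = (γ + Finsupp.single i 1).prod (fun i e => u i ^ e) := by
            rw [prod_pow_add, Finsupp.prod_single_index (h := fun i e => u i ^ e) (pow_zero _), pow_one,
              mul_comm]
          rw [e]
          refine prod_mem_weightedSpan u w ?_ ?_
          · intro j hj'
            rcases Finset.mem_union.mp (Finsupp.support_add hj') with h | h
            · exact hS' (hvarsQ γ (mem_support_iff.mp hγ) h)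
            · rw [Finsupp.support_single _ one_ne_zero, Finset.mem_singleton] at h
              rw [h]; exact hiS
          · rw [map_add, Finsupp.weight_single, smul_eq_mul, one_mul]
            have := hQw γ (mem_support_iff.mp hγ)
            omega
        have : Q.coeff γ * (u i * γ.prod (fun i e => u i ^ e)) ∈ J[↑S, 1] * J[↑S, n] :=
          Ideal.mul_mem_mul (span_le_weightedSpan_one u w (fun j hj => hw j hj) (hQcoeff γ)) hw1
        rw [add_comm n 1]
        exact weightedSpan_mul_le u w _ 1 n this
      have hP₀ev1 : MvPolynomial.eval u P₀ ∈ J[↑S, n + 1] := by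
        have e : MvPolynomial.eval u P₀ = (u i * MvPolynomial.eval u Q + MvPolynomial.eval u P₀) -
            u i * MvPolynomial.eval u Q := by ring
        rw [e]
        refine Ideal.sub_mem _ ?_ hQev1
        rw [weightedSpan_eq_sup u w (Finset.mem_coe.mpr hiS), ← haq]
        exact Submodule.add_mem_sup (Ideal.mul_mem_mul (Ideal.mem_span_singleton_self _) hj) hq
      have hP₀coeff : ∀ γ, P₀.coeff γ ∈ Ideal.span (u '' ↑S) :=
        ihS hS''S P₀ hP₀ hvars₀ hP₀ev1
      -- reassemble the coefficient of `P = Xᵢ Q + P₀`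
      rw [← hsplit, MvPolynomial.coeff_add, MvPolynomial.coeff_X_mul']
      refine Ideal.add_mem _ ?_ (hP₀coeff β)
      split_ifs
      · exact hQcoeff _
      · exact Ideal.zero_mem _

end Literature.AlgebraicGeometry.Resolution

end
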